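import Summits.Ventures.QEC.Census.CertBZPlane
import Summits.Ventures.QEC.Census.TwoBGA.S8_4x24_w6_k12_0001111.Cert
import HarnessLib

/-!
# `S8_4x24_w6_k12_0001111` — lane-engine replays, part 5/5 (census row `S8_4x24_w6_k12_0001111`; qec-search-4 orbit lane, emitted by qec-type-08 g7)

`Plane.segOK` verdicts (type-01 lane engine, `decide +kernel`) for segments of the kernel-basis replays of the views of
`Census/TwoBGA/S8_4x24_w6_k12_0001111/`; assembled in `Distance.lean`.  Generated by `tools/gen4/emit_orbit_row.py`; do not edit by hand.
-/

set_option autoImplicit false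
set_option Elab.async false

namespace Summit.Ventures.QEC.Census.S8_4x24_w6_k12_0001111

open Summit.Ventures.QEC.Census

set_option maxHeartbeats 400000000 in
/-- `X` view 0, lane segment `[95, 96)` (3326521 lanes, depth 5, threshold 11; est 9 s): every selection with largest row there passes (lane engine, KERNEL). -/
theorem psegX_0_11 : Plane.segOK 192 11 (S8_4x24_w6_k12_0001111.cert.sideX.found.map Prod.fst) S8_4x24_w6_k12_0001111.pGX_0 5 95 1 51 = true := by
  decide +kernel

set_option maxHeartbeats 400000000 in
/-- `X` view 0, lane segment `[96, 97)` (3469497 lanes, depth 5, threshold 11; est 14 s): every selection with largest row there passes (lane engine, KERNEL). -/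
theorem psegX_0_12 : Plane.segOK 192 11 (S8_4x24_w6_k12_0001111.cert.sideX.found.map Prod.fst) S8_4x24_w6_k12_0001111.pGX_0 5 96 1 51 = true := by
  decide +kernel

set_option maxHeartbeats 400000000 in
/-- `X` view 0, lane segment `[97, 98)` (3617034 lanes, depth 5, threshold 11; est 16 s): every selection with largest row there passes (lane engine, KERNEL). -/
theorem psegX_0_13 : Plane.segOK 192 11 (S8_4x24_w6_k12_0001111.cert.sideX.found.map Prod.fst) S8_4x24_w6_k12_0001111.pGX_0 5 97 1 51 = true := by
  decide +kernel

set_option maxHeartbeats 400000000 in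
/-- `X` view 0, lane segment `[98, 99)` (3769228 lanes, depth 5, threshold 11; est 12 s): every selection with largest row there passes (lane engine, KERNEL). -/
theorem psegX_0_14 : Plane.segOK 192 11 (S8_4x24_w6_k12_0001111.cert.sideX.found.map Prod.fst) S8_4x24_w6_k12_0001111.pGX_0 5 98 1 51 = true := by
  decide +kernel

set_option maxHeartbeats 400000000 in
/-- `X` view 0, lane segment `[99, 100)` (3926176 lanes, depth 5, threshold 11; est 12 s): every selection with largest row there passes (lane engine, KERNEL). -/
theorem psegX_0_15 : Plane.segOK 192 11 (S8_4x24_w6_k12_0001111.cert.sideX.found.map Prod.fst) S8_4x24_w6_k12_0001111.pGX_0 5 99 1 51 = true := by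
  decide +kernel

set_option maxHeartbeats 400000000 in
/-- `X` view 0, lane segment `[100, 101)` (4087976 lanes, depth 5, threshold 11; est 16 s): every selection with largest row there passes (lane engine, KERNEL). -/
theorem psegX_0_16 : Plane.segOK 192 11 (S8_4x24_w6_k12_0001111.cert.sideX.found.map Prod.fst) S8_4x24_w6_k12_0001111.pGX_0 5 100 1 51 = true := by
  decide +kernel

set_option maxHeartbeats 400000000 in
/-- `X` view 0, lane segment `[101, 102)` (4254727 lanes, depth 5, threshold 11; est 19 s): every selection with largest row there passes (lane engine, KERNEL). -/
theorem psegX_0_17 : Plane.segOK 192 11 (S8_4x24_w6_k12_0001111.cert.sideX.found.map Prod.fst) S8_4x24_w6_k12_0001111.pGX_0 5 101 1 51 = true := by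
  decide +kernel

end Summit.Ventures.QEC.Census.S8_4x24_w6_k12_0001111
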